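import Literature.Combinatorics.Matroid.HeppBoundDirectSum
import HarnessLib

/-!
# The Hepp bound of a disconnected matroid vanishes (Panzer 2022, Thm 2.19, `⇐`) — proved

Matroid form of the product formula of `HeppBoundDirectSum.lean`: if a finite matroid splits as a
direct sum `M = M|X ⊕ M|(E ∖ X)` along a non-empty proper `X` (Panzer 2022, Def. 2.15
[Panzer2022]: `M` is disconnected), then rank and corank are additive over the split
("`ℓ(γ) = ℓ(γ ∩ A) + ℓ(γ ∩ B)`", proof of Thm 2.19), hence so is `ω`, and the Hepp bound of
Def. 2.4 vanishes at every logarithmically divergent point off the poles (Thm 2.19: "`H(M, a⃗)`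
is identically zero on `{ω = 0}` if … `M` is disconnected"; the converse direction, positivity
on the convergence cone for connected `M`, is Lemma 2.16/Cor. 2.35 and is not formalised here).

## Contents

* `eRk_eq_add_of_eq_disjointSum`, `corank_eq_add_of_eq_disjointSum`,
  **`heppBoundDim_eq_zero_of_eq_disjointSum`**.
-/

noncomputable section

open Finset

namespace Literature.Combinatorics.Matroid

variable {α : Type*} {𝕜 : Type*} [Field 𝕜]

section MatroidForm

variable {M : Matroid α}

/-- Rank is additive over a direct-sum decomposition `M = M|X ⊕ M|(E ∖ X)`. [folklore] -/
theorem eRk_eq_add_of_eq_disjointSum {X : Set α} (hX : X ⊆ M.E)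
    (h : M = (M.restrict X).disjointSum (M.restrict (M.E \ X)) Set.disjoint_sdiff_right)
    (Y : Set α) (hY : Y ⊆ M.E) : M.eRk Y = M.eRk (Y ∩ X) + M.eRk (Y \ X) := by
  obtain ⟨I, hI⟩ := M.exists_isBasis Y hY
  have hI' := hI
  rw [h, Matroid.disjointSum_isBasis_iff] at hI'
  simp only [Matroid.restrict_ground_eq, Matroid.isBasis_restrict_iff'] at hI'
  obtain ⟨⟨h1, -⟩, ⟨h2, -⟩, -, -⟩ := hI'
  have hYX : Y ∩ (M.E \ X) = Y \ X := by
    ext y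
    simp only [Set.mem_inter_iff, Set.mem_sdiff]
    exact ⟨fun ⟨hy, _, hnx⟩ => ⟨hy, hnx⟩, fun ⟨hy, hnx⟩ => ⟨hy, hY hy, hnx⟩⟩
  rw [hYX, Set.inter_eq_self_of_subset_left (fun y hy => hY hy.1)] at h2
  rw [Set.inter_eq_self_of_subset_left (Set.inter_subset_left.trans hY)] at h1
  have hdisj : Disjoint (I ∩ X) (I ∩ (M.E \ X)) :=
    Set.disjoint_sdiff_right.mono Set.inter_subset_right Set.inter_subset_right
  rw [← hI.encard_eq_eRk, ← h1.encard_eq_eRk, ← h2.encard_eq_eRk, ← Set.encard_union_eq hdisj,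
    ← Set.inter_union_distrib_left, Set.union_sdiff_cancel' (by rfl) hX,
    Set.inter_eq_self_of_subset_left (hI.subset.trans hY)]

/-- Corank is additive over a direct-sum decomposition (Panzer 2022, proof of Thm 2.19:
"`ℓ(γ) = ℓ(γ ∩ A) + ℓ(γ ∩ B)`"). [cite: Panzer2022, Thm 2.19 (proof)] -/
theorem corank_eq_add_of_eq_disjointSum [DecidableEq α] [M.Finite] {X : Set α} (hX : X ⊆ M.E)
    (h : M = (M.restrict X).disjointSum (M.restrict (M.E \ X)) Set.disjoint_sdiff_right)
    (A : Finset α) (hA : (A : Set α) = X) (γ : Finset α) (hγ : γ ⊆ groundFinset M) :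
    corank M γ = corank M (γ ∩ A) + corank M (γ \ A) := by
  have hγE : (γ : Set α) ⊆ M.E := by
    intro x hx; exact mem_groundFinset.1 (hγ (Finset.mem_coe.1 hx))
  have hr := eRk_eq_add_of_eq_disjointSum hX h γ hγE
  rw [← hA, ← Finset.coe_inter, ← Finset.coe_sdiff] at hr
  have hfin : ∀ s : Finset α, M.eRk (s : Set α) ≠ ⊤ := fun s =>
    ne_top_of_le_ne_top (ENat.coe_ne_top s.card)
      (by rw [← Set.encard_coe_eq_coe_finsetCard]; exact M.eRk_le_encard _)
  have hr' : (M.eRk (γ : Set α)).toNat =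
      (M.eRk ((γ ∩ A : Finset α) : Set α)).toNat + (M.eRk ((γ \ A : Finset α) : Set α)).toNat := by
    have := congr_arg ENat.toNat hr
    rwa [ENat.toNat_add (hfin _) (hfin _)] at this
  have h1 := eRk_toNat_add_corank M γ
  have h2 := eRk_toNat_add_corank M (γ ∩ A)
  have h3 := eRk_toNat_add_corank M (γ \ A)
  have hcard : (γ ∩ A).card + (γ \ A).card = γ.card := Finset.card_inter_add_card_sdiff γ A
  omega

/-- **Thm 2.19 for matroids (the direction by shuffles), pointwise**: if the finite matroid `M`
splits as a direct sum `M|X ⊕ M|(E ∖ X)` along a non-empty proper `X` (i.e. `M` is disconnected,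
Def. 2.15), then its Hepp bound vanishes at every logarithmically divergent point
(`ω(M) = 0`) off the poles (`ω(γ) ≠ 0` for non-empty proper `γ`) — Panzer 2022, Thm 2.19:
"`H(M, a⃗)` is identically zero on `{ω(G) = 0}` if … `M` is disconnected". [cite: Panzer2022, Thm 2.19] -/
theorem heppBoundDim_eq_zero_of_eq_disjointSum [DecidableEq α] [M.Finite] {X : Set α}
    (hX : X ⊆ M.E) (hXne : X.Nonempty) (hXpr : X ≠ M.E)
    (h : M = (M.restrict X).disjointSum (M.restrict (M.E \ X)) Set.disjoint_sdiff_right)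
    (D : 𝕜) (a : α → 𝕜)
    (hω : ∀ γ : Finset α, γ ⊆ groundFinset M → γ.Nonempty → γ ≠ groundFinset M → sdc M D a γ ≠ 0)
    (hlog : sdc M D a (groundFinset M) = 0) :
    heppBoundDim M D a = 0 := by
  -- the two sides of the split as finsets
  set A : Finset α := (M.ground_finite.subset hX).toFinset with hAdef
  have hA : (A : Set α) = X := Set.Finite.coe_toFinset _
  set B : Finset α := groundFinset M \ A with hBdef
  have hAE : A ⊆ groundFinset M := by
    intro x hx
    rw [mem_groundFinset]
    exact hX (by rw [← hA]; exact Finset.mem_coe.2 hx)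
  have hE : groundFinset M = A ∪ B := by
    rw [hBdef, Finset.union_sdiff_of_subset hAE]
  have hAne : A.Nonempty := by
    obtain ⟨x, hx⟩ := hXne
    exact ⟨x, by rw [← Finset.mem_coe, hA]; exact hx⟩
  have hBne : B.Nonempty := by
    rw [hBdef, Finset.sdiff_nonempty]
    intro hsub
    apply hXpr
    rw [← hA, Finset.Subset.antisymm hAE hsub, coe_groundFinset]
  have hdisj : Disjoint A B := by rw [hBdef]; exact Finset.disjoint_sdiff
  have h0 : sdc M D a ∅ = 0 := by simp [sdc_apply]
  -- additivity of `ω = sdc` over `A ⊔ B`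
  have hadd : ∀ Y, Y ⊆ A ∪ B → sdc M D a Y = sdc M D a (Y ∩ A) + sdc M D a (Y ∩ B) := by
    intro Y hY
    rw [← hE] at hY
    have hYB : Y ∩ B = Y \ A := by
      ext y
      simp only [hBdef, Finset.mem_inter, Finset.mem_sdiff]
      exact ⟨fun ⟨hy, _, hnA⟩ => ⟨hy, hnA⟩, fun ⟨hy, hnA⟩ => ⟨hy, hY hy, hnA⟩⟩
    rw [hYB, sdc_apply, sdc_apply, sdc_apply, corank_eq_add_of_eq_disjointSum hX h A hA Y hY,
      ← Finset.sum_inter_add_sum_sdiff Y A a, Nat.cast_add]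
    ring
  rw [heppBoundDim, heppSumOfCorank_eq_heppSumFn, hE]
  refine heppSumFn_union_eq_zero (sdc M D a) h0 A B hAne hBne hdisj hadd ?_ (by rw [← hE, hlog])
  intro A' hA' B' hB' hne hpr
  refine hω _ ?_ hne (by rwa [hE])
  rw [hE]
  exact Finset.union_subset_union hA' hB'

end MatroidForm

end Literature.Combinatorics.Matroid
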